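import Mathlib

/-!
# Solo-blind: the nested mid-gap choice of the detuning (paper §24.35(2)(ii))

The dead stretch of the low branch carries two potential wells (the overshoot lobe and the main
centrifugal lobe, paper §24.27 addendum), exponentially decoupled.  The linearisation is singular
exactly when a level of either well crosses zero energy; as the detuning `δ` sweeps a compact
interval the zero-crossing values form two sets `Z₁` (coarse: consecutive crossings `≍ n^{-1/3}`
apart) and `Z₂` (fine: `g₂ ≍ n^{-1/2}`-separated).  "Mid-gap" is the NESTED choice: inside the
middle third of a gap `(u, v)` of `Z₁` pick `δ` at distance `≥ g₂/2` from `Z₂`; then `δ` is at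
distance `≥ (v-u)/3` from `Z₁` and `≥ g₂/2` from `Z₂`, and a level moving at rate `≥ w` in `δ` that
vanishes on `Z` is, at such a `δ`, at least `w ×` (that distance) away from zero.  Everything here is
real arithmetic; the spectral consequences (inverse bound `≤ 1/min |level|` for the symmetrised
well operator) are kernel #89 `SoloBlindSchurBlock` and §24.35(0).

* `exists_far_from_separated` — a `g`-separated set `Z ⊆ ℝ` and an interval of half-length `r ≥ g`
  admit a point of the interval at distance `≥ g/2` from `Z` (midpoint, or a crossing shifted by
  `g/2`).
* `nested_midgap` — the two-family statement above.
* `level_distance`, `levels_far` — distance in `δ` times velocity bounds the level from below.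
* `nested_midgap_levels` — the assembled statement used in §24.35(2)(ii).
-/

namespace Summit.AnomalousDissipation.AnomalousDissipation.Theorems

/-- A `g`-separated set of reals leaves, in every interval `[c - r, c + r]` with `r ≥ g > 0`, a point
at distance at least `g/2` from all of its elements: either the midpoint `c` already is such a
point, or some `z ∈ Z` lies within `g/2` of `c` and then `z + g/2` works. -/
theorem exists_far_from_separated (Z : Set ℝ) {g c r : ℝ} (hg : 0 < g) (hr : g ≤ r)
    (hsep : ∀ z ∈ Z, ∀ z' ∈ Z, z ≠ z' → g ≤ |z - z'|) :
    ∃ δ ∈ Set.Icc (c - r) (c + r), ∀ z ∈ Z, g / 2 ≤ |δ - z| := by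
  by_cases h : ∃ z ∈ Z, |z - c| < g / 2
  · obtain ⟨z, hz, hzc⟩ := h
    rw [abs_lt] at hzc
    refine ⟨z + g / 2, ⟨by linarith, by linarith⟩, ?_⟩
    intro z' hz'
    by_cases hzz : z = z'
    · subst hzz
      rw [show z + g / 2 - z = g / 2 by ring, abs_of_pos (by linarith)]
    · have hzz' := hsep z hz z' hz' hzz
      have e : z - z' = (z + g / 2 - z') + (-(g / 2)) := by ring
      have h1 : |z - z'| ≤ |z + g / 2 - z'| + g / 2 := by
        calc |z - z'| = |(z + g / 2 - z') + (-(g / 2))| := by rw [e]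
          _ ≤ |z + g / 2 - z'| + |-(g / 2)| := abs_add_le _ _
          _ = |z + g / 2 - z'| + g / 2 := by
              rw [abs_neg, abs_of_pos (by linarith : (0:ℝ) < g / 2)]
      linarith
  · push Not at h
    refine ⟨c, ⟨by linarith, by linarith⟩, ?_⟩
    intro z hz
    rw [abs_sub_comm]
    exact h z hz

/-- NESTED MID-GAP.  `Z₁` has a gap `(u, v)` (no element strictly inside) of length `≥ 6 g₂`, and `Z₂`
is `g₂`-separated, `g₂ > 0`.  Then some `δ ∈ [u, v]` is at distance `≥ (v - u)/3` from `Z₁` and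
`≥ g₂/2` from `Z₂`: apply `exists_far_from_separated` to the middle third of the gap. -/
theorem nested_midgap (Z₁ Z₂ : Set ℝ) {u v g₂ : ℝ} (hg : 0 < g₂) (huv : 6 * g₂ ≤ v - u)
    (hgap : ∀ z ∈ Z₁, z ≤ u ∨ v ≤ z)
    (hsep : ∀ z ∈ Z₂, ∀ z' ∈ Z₂, z ≠ z' → g₂ ≤ |z - z'|) :
    ∃ δ ∈ Set.Icc u v, (∀ z ∈ Z₁, (v - u) / 3 ≤ |δ - z|) ∧ (∀ z ∈ Z₂, g₂ / 2 ≤ |δ - z|) := by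
  obtain ⟨δ, ⟨hδ1, hδ2⟩, hfar⟩ :=
    exists_far_from_separated Z₂ (c := (u + v) / 2) (r := (v - u) / 6) hg (by linarith) hsep
  refine ⟨δ, ⟨by linarith, by linarith⟩, ?_, hfar⟩
  intro z hz
  rcases hgap z hz with h | h
  · rw [abs_of_nonneg (by linarith)]
    linarith
  · rw [abs_of_nonpos (by linarith)]
    linarith

/-- A level `E` that vanishes at `z₀` and moves at rate at least `w ≥ 0` in `δ`
(`w |a - b| ≤ |E a - E b|`) satisfies `w |δ - z₀| ≤ |E δ|`. -/
theorem level_distance {E : ℝ → ℝ} {w z₀ : ℝ} (hz : E z₀ = 0)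
    (hco : ∀ a b, w * |a - b| ≤ |E a - E b|) (δ : ℝ) : w * |δ - z₀| ≤ |E δ| := by
  have := hco δ z₀
  rw [hz, sub_zero] at this
  exact this

/-- Family version: levels `E k` with zeros `zero k ∈ Z`, common rate `w ≥ 0`; at a `δ` whose
distance from `Z` is at least `d`, every level is at least `w d` in absolute value. -/
theorem levels_far {ι : Type*} (E : ι → ℝ → ℝ) (zero : ι → ℝ) (Z : Set ℝ) {w d δ : ℝ}
    (hw : 0 ≤ w) (hzero : ∀ k, E k (zero k) = 0) (hmem : ∀ k, zero k ∈ Z)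
    (hco : ∀ k a b, w * |a - b| ≤ |E k a - E k b|) (hfar : ∀ z ∈ Z, d ≤ |δ - z|) :
    ∀ k, w * d ≤ |E k δ| := by
  intro k
  calc w * d ≤ w * |δ - zero k| := mul_le_mul_of_nonneg_left (hfar _ (hmem k)) hw
    _ ≤ |E k δ| := level_distance (hzero k) (hco k) δ

/-- THE STATEMENT USED IN §24.35(2)(ii).  Two wells: levels `E₁ k` (coarse family, zeros in `Z₁`,
rate `≥ w₁`) and `E₂ k` (fine family, zeros in the `g₂`-separated set `Z₂`, rate `≥ w₂`); a gap
`(u, v)` of `Z₁` of length `≥ 6 g₂`.  Then ONE detuning `δ ∈ [u, v]` keeps every level of well 1 at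
least `w₁ (v - u)/3` and every level of well 2 at least `w₂ g₂ / 2` away from zero.  In the paper
`v - u ≍ n^{-1/3}`, `w₁ = O(1)`; `g₂ ≍ n^{-1/2}`, `w₂ ≍ n^{1/3}`: both products are `≍` the
respective level spacings, so both wells are at mid-gap up to the factors `1/3`, `1/2`. -/
theorem nested_midgap_levels {ι₁ ι₂ : Type*} (E₁ : ι₁ → ℝ → ℝ) (E₂ : ι₂ → ℝ → ℝ)
    (zero₁ : ι₁ → ℝ) (zero₂ : ι₂ → ℝ) (Z₁ Z₂ : Set ℝ) {u v g₂ w₁ w₂ : ℝ}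
    (hg : 0 < g₂) (huv : 6 * g₂ ≤ v - u) (hw₁ : 0 ≤ w₁) (hw₂ : 0 ≤ w₂)
    (hgap : ∀ z ∈ Z₁, z ≤ u ∨ v ≤ z)
    (hsep : ∀ z ∈ Z₂, ∀ z' ∈ Z₂, z ≠ z' → g₂ ≤ |z - z'|)
    (hzero₁ : ∀ k, E₁ k (zero₁ k) = 0) (hmem₁ : ∀ k, zero₁ k ∈ Z₁)
    (hco₁ : ∀ k a b, w₁ * |a - b| ≤ |E₁ k a - E₁ k b|)
    (hzero₂ : ∀ k, E₂ k (zero₂ k) = 0) (hmem₂ : ∀ k, zero₂ k ∈ Z₂)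
    (hco₂ : ∀ k a b, w₂ * |a - b| ≤ |E₂ k a - E₂ k b|) :
    ∃ δ ∈ Set.Icc u v,
      (∀ k, w₁ * ((v - u) / 3) ≤ |E₁ k δ|) ∧ (∀ k, w₂ * (g₂ / 2) ≤ |E₂ k δ|) := by
  obtain ⟨δ, hδ, hfar₁, hfar₂⟩ := nested_midgap Z₁ Z₂ hg huv hgap hsep
  exact ⟨δ, hδ, levels_far E₁ zero₁ Z₁ hw₁ hzero₁ hmem₁ hco₁ hfar₁,
    levels_far E₂ zero₂ Z₂ hw₂ hzero₂ hmem₂ hco₂ hfar₂⟩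

end Summit.AnomalousDissipation.AnomalousDissipation.Theorems
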